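import Mathlib
import HarnessLib
import Summits.QuantumFields.YangMills.Theorems.ConvexGribovBodyContinuumLegGivenGapStubUclOfCsclA

/-!
# `ContinuumLegGivenGap` (stmt-QuantumFields-15828), line `Sketch` (reshape 15): kinematics for `stub_uclOfCscl` — the tilt

Support file for the crux item stmt-QuantumFields-15828 (registered glue stub `stub_uclOfCscl`, reshape 15). Part B is
the TILT: for finite families of slab-ordered real product tensors with time- and `x^{i+1}`-bounded factors and a
determinant-one isometry `R` of `ℝ⁴` with `(Rx)⁰ = c x⁰ + s x^{i+1}`, `c ∈ (0,1]`, `(1−c)`, `|s|` small against the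
slab margins (the landed `stub_smallRotation`),
* `conjRot_apply_zero`, `linActMulti_osAdjoint_conj` — `R · ΘP* = Θ(R'·P)*` with `R' = θRθ`, `(R'x)⁰ = c x⁰ − s x^{i+1}`;
* `tsupport_tilt_subset`, `isSlabOrdered_tilt` — tilted (and spatially translated) slab-ordered bounded factor data
  stay slab-ordered;
* scalar bookkeeping for the main term (`tilt_final_estimate`) and the registered sub-goal `stub_uclOfCsclTilt`
  (closed form of `isSlabOrdered_tilt`). The main term on the spans is in part B. [folklore]
-/

noncomputable section

namespace Summit.QuantumFields.YangMills.Theorems.ContinuumLegGivenGap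

open scoped SchwartzMap ComplexConjugate
open Filter Topology MeasureTheory
open Literature.MathematicalPhysics.QuantumFieldTheory Literature.MathematicalPhysics.QuantumLattice
  Literature.MathematicalPhysics.AQFT Literature.Probability.LatticeModels
open Summit.QuantumFields.YangMills.Cruxes.ContinuumLimitOnTrajectory.TwoOrbitSynchronisation
  (curvDistribution curvCLM curvCLM_apply curvDistribution_sub curvDistribution_zero curvDistribution_smul
   curvDistribution_add canon UUVB UVB ARP AsympTransl PolyVolumeGrowth PlaqIdx stub_transl)
open Summit.QuantumFields.YangMills.Cruxes.LatticeGapOnTrajectory.OrbitKantorovichFiniteSize.Transfer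
  (tsupport_translateTest_subset)

/-! ## §1 Elementary real facts -/

/-- Finitely many positive reals have a common positive lower bound. [folklore] -/
theorem exists_pos_le_forall {ι : Type*} [Finite ι] (f : ι → ℝ) (hf : ∀ i, 0 < f i) :
    ∃ δ : ℝ, 0 < δ ∧ ∀ i, δ ≤ f i := by
  classical
  haveI := Fintype.ofFinite ι
  rcases isEmpty_or_nonempty ι with hι | hι
  · exact ⟨1, one_pos, fun i => (IsEmpty.false i).elim⟩
  · obtain ⟨i₀, -, hi₀⟩ := Finset.exists_min_image Finset.univ f Finset.univ_nonempty
    exact ⟨f i₀, hf i₀, fun i => hi₀ i (Finset.mem_univ _)⟩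

/-- A term of a finite real family is at most one plus the sum of the absolute values. [folklore] -/
theorem le_one_add_sum_abs {ι : Type*} [Fintype ι] (f : ι → ℝ) (i : ι) : f i ≤ 1 + ∑ j, |f j| := by
  have h1 : f i ≤ |f i| := le_abs_self _
  have h2 : |f i| ≤ ∑ j, |f j| :=
    Finset.single_le_sum (f := fun j => |f j|) (fun j _ => abs_nonneg _) (Finset.mem_univ i)
  linarith

/-! ## §2 The conjugate rotation and the OS adjoint -/

/-- **`R · ΘP* = Θ(R'·P)*`** with the time-reflection conjugate `R' = θ ∘ R ∘ θ` (as in route LangevinControlUV's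
`linActMulti_osAdjoint`). [folklore] -/
theorem linActMulti_osAdjoint_conj {n : ℕ} (R : EuclideanSpace ℝ (Fin 4) ≃ₗᵢ[ℝ] EuclideanSpace ℝ (Fin 4))
    (P : 𝓢((Fin n → EuclideanSpace ℝ (Fin 4)), ℂ)) :
    linActMulti R (osAdjoint P) =
      osAdjoint (linActMulti ((timeReflection 4).trans (R.trans (timeReflection 4))) P) := by
  ext x
  simp [linActMulti_apply, osAdjoint_apply, LinearIsometryEquiv.symm_trans, timeReflection_symm,
    timeReflection_timeReflection]

/-- **Time component of the conjugate rotation**: if `(Rx)⁰ = c x⁰ + s x^{i+1}` then `(θRθ x)⁰ = c x⁰ − s x^{i+1}`.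
[folklore] -/
theorem conjRot_apply_zero (R : EuclideanSpace ℝ (Fin 4) ≃ₗᵢ[ℝ] EuclideanSpace ℝ (Fin 4)) {i : Fin 3} {c s : ℝ}
    (hR : ∀ x : EuclideanSpace ℝ (Fin 4), R x 0 = c * x 0 + s * x i.succ) (x : EuclideanSpace ℝ (Fin 4)) :
    ((timeReflection 4).trans (R.trans (timeReflection 4))) x 0 = c * x 0 - s * x i.succ := by
  simp only [LinearIsometryEquiv.trans_apply, timeReflection_apply, if_true, hR, Fin.succ_ne_zero, if_false]
  ring

/-! ## §3 Tilted slab data -/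

/-- Support of a rotated one-point test function: `supp (L·f) ⊆ L(supp f)` in preimage form. [folklore] -/
theorem tsupport_linActTest_subset (L : EuclideanSpace ℝ (Fin 4) ≃ₗᵢ[ℝ] EuclideanSpace ℝ (Fin 4))
    (f : 𝓢(EuclideanSpace ℝ (Fin 4), ℝ)) :
    tsupport (linActTest L f : EuclideanSpace ℝ (Fin 4) → ℝ) ⊆ L.symm ⁻¹' tsupport (f : EuclideanSpace ℝ (Fin 4) → ℝ) := by
  rw [show (linActTest L f : EuclideanSpace ℝ (Fin 4) → ℝ) = fun y => f (L.symm y) from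
    funext fun y => linActTest_apply L f y]
  exact tsupport_schwartz_comp_subset f L.symm.continuous

/-- **Time window of a tilted, spatially translated factor.** If `f` is supported in the time slab `[lo, hi]`
(`0 ≤ hi ≤ T`) with `|x^{i+1}| ≤ ρ` there, `L` is an isometry with `(Ly)⁰ = c y⁰ + s y^{i+1}`, `0 < c ≤ 1`, and `w` is
spatial, then `T_w (L·f)` is supported in the time slab `[lo − marg, hi + marg]` for any `marg ≥ (1 − c) T + |s| ρ`.
[folklore] -/
theorem tsupport_tilt_subset {f : 𝓢(EuclideanSpace ℝ (Fin 4), ℝ)} {lo hi T ρ : ℝ}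
    (hsupp : tsupport (f : EuclideanSpace ℝ (Fin 4) → ℝ) ⊆ {x | lo ≤ x 0 ∧ x 0 ≤ hi}) (hhi : 0 ≤ hi) (hT : hi ≤ T)
    {i : Fin 3} (hρ : tsupport (f : EuclideanSpace ℝ (Fin 4) → ℝ) ⊆ {x | |x i.succ| ≤ ρ})
    (L : EuclideanSpace ℝ (Fin 4) ≃ₗᵢ[ℝ] EuclideanSpace ℝ (Fin 4)) {c s : ℝ}
    (hL : ∀ y : EuclideanSpace ℝ (Fin 4), L y 0 = c * y 0 + s * y i.succ) (hc0 : 0 < c) (hc1 : c ≤ 1)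
    {marg : ℝ} (hmarg : (1 - c) * T + |s| * ρ ≤ marg) {w : EuclideanSpace ℝ (Fin 4)} (hw : w 0 = 0) :
    tsupport (translateTest w (linActTest L f) : EuclideanSpace ℝ (Fin 4) → ℝ) ⊆
      {x | lo - marg ≤ x 0 ∧ x 0 ≤ hi + marg} := by
  intro x hx
  have h1 := tsupport_translateTest_subset w (linActTest L f) hx
  have h2 := tsupport_linActTest_subset L f h1
  simp only [Set.mem_preimage] at h2
  set y := L.symm (x - w) with hy
  have hy0 := hsupp h2
  have hyρ := hρ h2
  simp only [Set.mem_setOf_eq] at hy0 hyρ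
  have hx0 : x 0 = c * y 0 + s * y i.succ := by
    have : L y = x - w := by rw [hy, LinearIsometryEquiv.apply_symm_apply]
    have h := hL y
    rw [this, PiLp.sub_apply, hw, sub_zero] at h
    exact h
  have hsy : |s * y i.succ| ≤ |s| * ρ := by
    rw [abs_mul]; exact mul_le_mul_of_nonneg_left hyρ (abs_nonneg _)
  have hsy1 := (abs_le.1 (le_trans (le_of_eq rfl) hsy)).1
  have hsy2 := (abs_le.1 (le_trans (le_of_eq rfl) hsy)).2
  refine ⟨?_, ?_⟩
  · -- lower end: `c y⁰ ≥ lo − (1 − c) T`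
    have h3 : (1 - c) * y 0 ≤ (1 - c) * T := mul_le_mul_of_nonneg_left (hy0.2.trans hT) (by linarith)
    rw [hx0]
    nlinarith
  · have h3 : c * y 0 ≤ hi := by nlinarith [hy0.2, hy0.1]
    have h4 : 0 ≤ (1 - c) * T := mul_nonneg (by linarith) (hhi.trans hT)
    rw [hx0]
    linarith

/-- **Tilted, spatially translated slab-ordered bounded data are slab-ordered.** For slab-ordered real factor data
`p` (slabs `[lo u, hi u]`, all `hi u ≤ T`, all factors supported in `|x^{i+1}| ≤ ρ`), an isometry `L` with
`(Ly)⁰ = c y⁰ + s y^{i+1}`, `0 < c ≤ 1`, a margin `marg ≥ (1−c)T + |s|ρ` that is smaller than every `lo u` and than half of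
every gap, and a spatial `w`, the data `u ↦ T_w (L · p u)` are slab-ordered. [folklore] -/
theorem isSlabOrdered_tilt {n : ℕ} {p : Fin n → 𝓢(EuclideanSpace ℝ (Fin 4), ℝ)} {lo hi : Fin n → ℝ}
    (hlo : ∀ u, 0 < lo u) (hle : ∀ u, lo u ≤ hi u)
    (hsupp : ∀ u, tsupport (p u : EuclideanSpace ℝ (Fin 4) → ℝ) ⊆ {x | lo u ≤ x 0 ∧ x 0 ≤ hi u})
    {i : Fin 3} {ρ T : ℝ} (hρ : ∀ u, tsupport (p u : EuclideanSpace ℝ (Fin 4) → ℝ) ⊆ {x | |x i.succ| ≤ ρ})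
    (hT : ∀ u, hi u ≤ T) (L : EuclideanSpace ℝ (Fin 4) ≃ₗᵢ[ℝ] EuclideanSpace ℝ (Fin 4)) {c s : ℝ}
    (hL : ∀ y : EuclideanSpace ℝ (Fin 4), L y 0 = c * y 0 + s * y i.succ) (hc0 : 0 < c) (hc1 : c ≤ 1)
    {marg : ℝ} (hmarg0 : 0 ≤ marg) (hmarg : (1 - c) * T + |s| * ρ ≤ marg) (hm1 : ∀ u, marg < lo u)
    (hm2 : ∀ u u', u < u' → hi u + marg < lo u' - marg) {w : EuclideanSpace ℝ (Fin 4)} (hw : w 0 = 0) :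
    IsSlabOrdered (fun u => translateTest w (linActTest L (p u))) := by
  refine ⟨fun u => lo u - marg, fun u => hi u + marg, fun u => by linarith [hm1 u], fun u => ?_, hm2, fun u => ?_⟩
  · linarith [hle u]
  · exact tsupport_tilt_subset (hsupp u) ((hlo u).le.trans (hle u)) (hT u) (hρ u) L hL hc0 hc1 hmarg hw

/-- Translation by `0` is the identity on one-point test functions. [folklore] -/
theorem translateTest_zero' (f : 𝓢(EuclideanSpace ℝ (Fin 4), ℝ)) : translateTest (0 : EuclideanSpace ℝ (Fin 4)) f = f := by
  ext x; simp [translateTest_apply]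

/-- The `w = 0` case of `isSlabOrdered_tilt`: tilted slab-ordered bounded data are slab-ordered. [folklore] -/
theorem isSlabOrdered_tilt₀ {n : ℕ} {p : Fin n → 𝓢(EuclideanSpace ℝ (Fin 4), ℝ)} {lo hi : Fin n → ℝ}
    (hlo : ∀ u, 0 < lo u) (hle : ∀ u, lo u ≤ hi u)
    (hsupp : ∀ u, tsupport (p u : EuclideanSpace ℝ (Fin 4) → ℝ) ⊆ {x | lo u ≤ x 0 ∧ x 0 ≤ hi u})
    {i : Fin 3} {ρ T : ℝ} (hρ : ∀ u, tsupport (p u : EuclideanSpace ℝ (Fin 4) → ℝ) ⊆ {x | |x i.succ| ≤ ρ})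
    (hT : ∀ u, hi u ≤ T) (L : EuclideanSpace ℝ (Fin 4) ≃ₗᵢ[ℝ] EuclideanSpace ℝ (Fin 4)) {c s : ℝ}
    (hL : ∀ y : EuclideanSpace ℝ (Fin 4), L y 0 = c * y 0 + s * y i.succ) (hc0 : 0 < c) (hc1 : c ≤ 1)
    {marg : ℝ} (hmarg0 : 0 ≤ marg) (hmarg : (1 - c) * T + |s| * ρ ≤ marg) (hm1 : ∀ u, marg < lo u)
    (hm2 : ∀ u u', u < u' → hi u + marg < lo u' - marg) :
    IsSlabOrdered (fun u => linActTest L (p u)) := by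
  have h := isSlabOrdered_tilt hlo hle hsupp hρ hT L hL hc0 hc1 hmarg0 hmarg hm1 hm2
    (w := (0 : EuclideanSpace ℝ (Fin 4))) rfl
  simpa only [translateTest_zero'] using h

/-! ## §4 Scalar bookkeeping for the main term -/

/-- The error budget of the lower correction term. [folklore] -/
theorem etaQ_mul_le {η A : ℝ} (hη : 0 < η) (hA : 0 ≤ A) : η / (4 * (A + 2)) * (A + 1) ≤ η / 4 := by
  rw [div_mul_eq_mul_div, div_le_div_iff₀ (by positivity) (by positivity)]
  nlinarith

/-- The error budget of the upper correction term. [folklore] -/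
theorem mul_etaP_le {η B : ℝ} (hη : 0 < η) (hB : 0 ≤ B) : B * min 1 (η / (4 * (B + 1))) ≤ η / 4 := by
  calc B * min 1 (η / (4 * (B + 1))) ≤ B * (η / (4 * (B + 1))) := mul_le_mul_of_nonneg_left (min_le_right _ _) hB
    _ ≤ η / 4 := by
        rw [mul_div_assoc', div_le_div_iff₀ (by positivity) (by positivity)]
        nlinarith

/-- **The final estimate at a fixed step** (pure normed-field bookkeeping): the truncated pairing is controlled by the
tilt-invariance error on the joint tensor, the Cauchy–Schwarz main term on the tilted objects, and the correction
terms replacing the tilted lower/upper distributions by the original ones. [folklore] -/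
theorem tilt_final_estimate {DH DRH DPR DP₀ DQRT DQR DQ₀ : ℂ} {CS η ηP ηQ AQ AP : ℝ}
    (hAP : 0 ≤ AP) (hηP1 : ηP ≤ 1) (hηQ0 : 0 ≤ ηQ)
    (hηQ : ηQ * (AQ + 1) ≤ η / 4) (hηPb : AP * ηP ≤ η / 4)
    (hk1 : ‖DRH - DH‖ ≤ η / 4) (hmain : ‖DRH - DPR * DQRT‖ ≤ CS + η / 4)
    (hk2 : ‖DPR - DP₀‖ ≤ ηQ) (hk3a : ‖DQRT - DQR‖ ≤ ηP / 2) (hk3b : ‖DQR - DQ₀‖ ≤ ηP / 2)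
    (hQ : ‖DQ₀‖ ≤ AQ) (hP : ‖DP₀‖ ≤ AP) :
    ‖DH - DP₀ * DQ₀‖ ≤ CS + η := by
  have hT3 : ‖DQRT - DQ₀‖ ≤ ηP := by
    have e : DQRT - DQ₀ = (DQRT - DQR) + (DQR - DQ₀) := by ring
    rw [e]; refine (norm_add_le _ _).trans ?_; linarith
  have hQk : ‖DQRT‖ ≤ AQ + 1 := by
    calc ‖DQRT‖ ≤ ‖DQ₀‖ + ‖DQRT - DQ₀‖ := norm_le_insert' _ _
      _ ≤ AQ + 1 := by linarith
  have hcorr : ‖DPR * DQRT - DP₀ * DQ₀‖ ≤ η / 4 + η / 4 := by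
    have e : DPR * DQRT - DP₀ * DQ₀ = (DPR - DP₀) * DQRT + DP₀ * (DQRT - DQ₀) := by ring
    rw [e]
    refine (norm_add_le _ _).trans (add_le_add ?_ ?_)
    · rw [norm_mul]
      exact (mul_le_mul hk2 hQk (norm_nonneg _) hηQ0).trans hηQ
    · rw [norm_mul]
      exact (mul_le_mul hP hT3 (norm_nonneg _) hAP).trans hηPb
  have e : DH - DP₀ * DQ₀ = (DH - DRH) + (DRH - DPR * DQRT) + (DPR * DQRT - DP₀ * DQ₀) := by ring
  have hk1' : ‖DH - DRH‖ ≤ η / 4 := by rw [norm_sub_rev]; exact hk1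
  rw [e]
  calc ‖DH - DRH + (DRH - DPR * DQRT) + (DPR * DQRT - DP₀ * DQ₀)‖
      ≤ ‖DH - DRH‖ + ‖DRH - DPR * DQRT‖ + ‖DPR * DQRT - DP₀ * DQ₀‖ := norm_add₃_le
    _ ≤ η / 4 + (CS + η / 4) + (η / 4 + η / 4) := add_le_add (add_le_add hk1' hmain) hcorr
    _ = CS + η := by ring


/-! ## §5 The registered sub-goal of the tilt file -/

/-- `stub_uclOfCsclTilt` — **tilted, spatially translated slab-ordered bounded data are slab-ordered** (registered
sub-goal of stmt-QuantumFields-15828, line `Sketch`, reshape 15; closed form of `isSlabOrdered_tilt`). [folklore] -/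
theorem stub_uclOfCsclTilt :
    ∀ (n : ℕ) (p : Fin n → SchwartzMap (EuclideanSpace ℝ (Fin 4)) ℝ) (lo hi : Fin n → ℝ), (∀ u, 0 < lo u) → (∀ u, lo u ≤ hi u) → (∀ u, tsupport (p u : EuclideanSpace ℝ (Fin 4) → ℝ) ⊆ {x | lo u ≤ x 0 ∧ x 0 ≤ hi u}) → ∀ (i : Fin 3) (ρ T : ℝ), (∀ u, tsupport (p u : EuclideanSpace ℝ (Fin 4) → ℝ) ⊆ {x | |x i.succ| ≤ ρ}) → (∀ u, hi u ≤ T) → ∀ (L : EuclideanSpace ℝ (Fin 4) ≃ₗᵢ[ℝ] EuclideanSpace ℝ (Fin 4)) (c s : ℝ), (∀ y : EuclideanSpace ℝ (Fin 4), L y 0 = c * y 0 + s * y i.succ) → 0 < c → c ≤ 1 → ∀ (marg : ℝ), 0 ≤ marg → (1 - c) * T + |s| * ρ ≤ marg → (∀ u, marg < lo u) → (∀ u u', u < u' → hi u + marg < lo u' - marg) → ∀ (w : EuclideanSpace ℝ (Fin 4)), w 0 = 0 → IsSlabOrdered (fun u => translateTest w (linActTest L (p u))) :=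
  fun _ _ _ _ hlo hle hsupp _ _ _ hρ hT L _ _ hL hc0 hc1 _ hmarg0 hmarg hm1 hm2 _ hw =>
    isSlabOrdered_tilt hlo hle hsupp hρ hT L hL hc0 hc1 hmarg0 hmarg hm1 hm2 hw

end Summit.QuantumFields.YangMills.Theorems.ContinuumLegGivenGap

end
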